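import Summits.CriticalPhenomena.SAWScalingLimit.Theorems.SAWDefectDecoherenceBoundaryClosureRDevelopingMapsCompactSteps

/-!
# Developing maps: lattice geometry and the local link at one scale (crux `BoundaryClosureR`,
stmt-CriticalPhenomena-14004, line `pick-half-plane`, stub `stub_developingMapsCompact`)

Support file (topic: elementary geometry of sites, faces and mid-edges of the triangular /
hexagonal lattice pair, and the ONE-SCALE form of the equi-Lipschitz estimate for the normalised
developing maps `h_δ = δ (H − H(s_b))/F(b)`).

* rows and distances: a vertex of a face lies in the rows `row(f)`, `row(f)+1` and within distance
  `1` of its centre; two adjacent faces in different rows are an up-face above the down-face SOUTH of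
  it (`adj_rows`), so the common vertices of a floor edge are its two floor sites;
* `core_link`: at one scale `δ ≤ η`, if the up-faces near `z` (rows `≥` the lower of two sites
  `s, s'` in `closedBall z η`) lie in `Λ` and the observable is bounded by `C·‖F(b₀)‖` on the nearby
  up-edges and floor edges, then `H s' − H s` does not depend on the potential `H` and
  `‖δ (H s' − H s)/F(b₀)‖ ≤ 6C (‖δ s' − δ s‖ + δ)` (the box link `box_link` along an up–across–up
  path of `O(‖s' − s‖ + 1)` steps).  Pure lattice bookkeeping (Duminil-Copin–Smirnov 2012, §4).
-/

noncomputable section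

open Literature.Probability.LatticeModels Literature.Probability.RandomPlanarGeometry
open Literature.Probability.RandomPlanarGeometry.SAW

namespace Summit.CriticalPhenomena.SAWScalingLimit.Theorems.PickHalfPlane.DevelopingMaps

/-! ### Rows, columns and distances of the vertices of a face -/

/-- `‖ζ‖ = 1`. [folklore] -/
theorem norm_triZeta : ‖triZeta‖ = 1 := by
  rw [← Real.sqrt_sq (norm_nonneg _), ← Complex.normSq_eq_norm_sq, normSq_triZeta, Real.sqrt_one]

/-- The vertices of a face lie in its row or the next one, and in its column or the next one.
[folklore] -/
theorem rows_of_mem_hexFaceVertices {f : HexVertex} {s : Site 2} (h : s ∈ hexFaceVertices f) :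
    f.1 1 ≤ s 1 ∧ s 1 ≤ f.1 1 + 1 ∧ f.1 0 ≤ s 0 ∧ s 0 ≤ f.1 0 + 1 := by
  obtain ⟨y, k⟩ := f
  fin_cases k
  · simp only [Fin.zero_eta] at h
    rw [mem_hexFaceVertices_zero] at h
    rcases h with rfl | rfl | rfl <;> simp
  · simp only [Fin.mk_one] at h
    rw [mem_hexFaceVertices_one] at h
    rcases h with rfl | rfl | rfl <;> simp

/-- A vertex of a face lies within distance `1` of its centre (the exact distance is `1/√3`).
[folklore] -/
theorem norm_triEmbed_sub_hexCenter_le {f : HexVertex} {s : Site 2} (h : s ∈ hexFaceVertices f) :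
    ‖triEmbed s - hexCenter f‖ ≤ 1 := by
  have hz := norm_triZeta
  have h3 : ‖(3 : ℂ)‖ = 3 := by simp
  have hA : ‖(1 : ℂ) + triZeta‖ ≤ 2 := by
    calc ‖(1 : ℂ) + triZeta‖ ≤ ‖(1 : ℂ)‖ + ‖triZeta‖ := norm_add_le _ _
      _ = 2 := by rw [norm_one, hz]; norm_num
  have hB : ‖(2 : ℂ) - triZeta‖ ≤ 3 := by
    calc ‖(2 : ℂ) - triZeta‖ ≤ ‖(2 : ℂ)‖ + ‖triZeta‖ := norm_sub_le _ _
      _ = 3 := by rw [Complex.norm_two, hz]; norm_num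
  have hC : ‖2 * triZeta - (1 : ℂ)‖ ≤ 3 := by
    calc ‖2 * triZeta - (1 : ℂ)‖ ≤ ‖2 * triZeta‖ + ‖(1 : ℂ)‖ := norm_sub_le _ _
      _ = 3 := by rw [norm_mul, Complex.norm_two, hz, norm_one]; norm_num
  have key : ∀ w : ℂ, ‖w‖ ≤ 3 → ‖w / 3‖ ≤ 1 := fun w hw => by
    rw [norm_div, h3]; linarith
  obtain ⟨y, k⟩ := f
  have hk : k = 0 ∨ k = 1 := by
    rcases Fin.exists_fin_two.1 ⟨k, rfl⟩ with h | h
    · exact Or.inl h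
    · exact Or.inr h
  rcases hk with rfl | rfl
  · rw [mem_hexFaceVertices_zero] at h
    rcases h with h | h | h <;> rw [h]
    · rw [show triEmbed y - hexCenter (y, 0) = -((1 + triZeta) / 3) by simp [hexCenter],
        norm_neg]
      exact key _ (by linarith)
    · rw [show triEmbed (y + Pi.single 0 1) - hexCenter (y, 0) = (2 - triZeta) / 3 by
        rw [triEmbed_add, triEmbed_single_zero]; simp [hexCenter]; ring]
      exact key _ hB
    · rw [show triEmbed (y + Pi.single 1 1) - hexCenter (y, 0) = (2 * triZeta - 1) / 3 by
        rw [triEmbed_add, triEmbed_single_one]; simp [hexCenter]; ring]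
      exact key _ hC
  · rw [mem_hexFaceVertices_one] at h
    rcases h with h | h | h <;> rw [h]
    · rw [show triEmbed (y + Pi.single 0 1) - hexCenter (y, 1) = -((2 * triZeta - 1) / 3) by
        rw [triEmbed_add, triEmbed_single_zero]; simp [hexCenter]; ring, norm_neg]
      exact key _ hC
    · rw [show triEmbed (y + Pi.single 1 1) - hexCenter (y, 1) = -((2 - triZeta) / 3) by
        rw [triEmbed_add, triEmbed_single_one]; simp [hexCenter]; ring, norm_neg]
      exact key _ hB
    · rw [show triEmbed (y + (Pi.single 0 1 + Pi.single 1 1)) - hexCenter (y, 1) = (1 + triZeta) / 3 by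
        rw [triEmbed_add, triEmbed_add, triEmbed_single_zero, triEmbed_single_one]
        simp [hexCenter]; ring]
      exact key _ (by linarith)

/-- **Adjacent faces in different rows**: if `u ∼ v` in `ℍ` and `u` lies in a lower row than `v`,
then `v` is the up-face `upFace k m` and `u` the down-face `belowFace k m` hanging below it.
[folklore] -/
theorem adj_rows {u v : HexVertex} (hadj : hexGraph.Adj u v) (hlt : u.1 1 < v.1 1) :
    v = upFace (v.1 0) (v.1 1) ∧ u = belowFace (v.1 0) (v.1 1) := by
  obtain ⟨yu, ku⟩ := u
  obtain ⟨yv, kv⟩ := v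
  have hyv : yv = ![yv 0, yv 1] := by ext i; fin_cases i <;> simp
  fin_cases ku <;> fin_cases kv
  · exact absurd hadj (not_hexGraph_adj_of_snd_eq_holds _ _ rfl)
  · exfalso
    simp only [Fin.zero_eta, Fin.mk_one] at hadj hlt
    rcases (hexGraph_adj_iff_of_snd_eq_zero_holds yu yv).1 hadj with rfl | rfl | rfl
    · simp at hlt
    · simp at hlt
    · simp at hlt; omega
  · simp only [Fin.zero_eta, Fin.mk_one] at hadj hlt ⊢
    rcases (hexGraph_adj_iff_of_snd_eq_one yu yv).1 hadj with rfl | h | h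
    · simp at hlt
    · exfalso; rw [h] at hlt; simp at hlt
    · refine ⟨?_, ?_⟩
      · unfold upFace; exact congrArg (fun t => (t, (0 : Fin 2))) hyv
      · unfold belowFace
        refine congrArg (fun t => (t, (1 : Fin 2))) ?_
        have : yu = yv - Pi.single 1 1 := by rw [h]; abel
        rw [this]; ext i; fin_cases i <;> simp [sub_eq_add_neg]
  · exact absurd hadj (not_hexGraph_adj_of_snd_eq_holds _ _ rfl)

/-- The common vertices of a floor edge are its two floor sites `![k, m]`, `![k+1, m]`. [folklore] -/
theorem eq_floorSites_of_mem {k m : ℤ} {s : Site 2} (hu : s ∈ hexFaceVertices (upFace k m))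
    (hb : s ∈ hexFaceVertices (belowFace k m)) : s = ![k, m] ∨ s = ![k + 1, m] := by
  unfold upFace at hu
  unfold belowFace at hb
  rw [mem_hexFaceVertices_zero] at hu
  rw [mem_hexFaceVertices_one] at hb
  rcases hu with rfl | rfl | h
  · exact Or.inl rfl
  · exact Or.inr (by ext i; fin_cases i <;> simp)
  · exfalso
    rcases hb with h' | h' | h' <;>
      · rw [h] at h'; have := congrFun h' 1; simp at this; try omega

/-- Distances along the lattice axes: `‖triEmbed ![k, l] − triEmbed ![i, j]‖ ≤ |k − i| + |l − j|`.
[folklore] -/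
theorem norm_triEmbed_vec2_sub_le (k l i j : ℤ) :
    ‖triEmbed ![k, l] - triEmbed ![i, j]‖ ≤ |((k - i : ℤ) : ℝ)| + |((l - j : ℤ) : ℝ)| := by
  have h : triEmbed ![k, l] - triEmbed ![i, j] = ((k - i : ℤ) : ℂ) + ((l - j : ℤ) : ℂ) * triZeta := by
    simp [triEmbed]; ring
  rw [h]
  calc _ ≤ ‖((k - i : ℤ) : ℂ)‖ + ‖((l - j : ℤ) : ℂ) * triZeta‖ := norm_add_le _ _
    _ = _ := by rw [norm_mul, norm_triZeta, mul_one, Complex.norm_intCast, Complex.norm_intCast]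

/-- Axis offsets are controlled by the embedded distance: `|Δ₀|, |Δ₁| ≤ 2 ‖triEmbed s' − triEmbed s‖`.
[folklore] -/
theorem abs_sub_le_two_mul_norm (i j i' j' : ℤ) :
    |((i' - i : ℤ) : ℝ)| ≤ 2 * ‖triEmbed ![i', j'] - triEmbed ![i, j]‖ ∧
      |((j' - j : ℤ) : ℝ)| ≤ 2 * ‖triEmbed ![i', j'] - triEmbed ![i, j]‖ := by
  have hsub : triEmbed ![i', j'] - triEmbed ![i, j] = triEmbed (![i', j'] - ![i, j]) :=
    (triEmbed_sub _ _).symm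
  have h0 := abs_le_two_mul_norm_triEmbed (![i', j'] - ![i, j]) 0
  have h1 := abs_le_two_mul_norm_triEmbed (![i', j'] - ![i, j]) 1
  rw [hsub]
  simp only [Pi.sub_apply, Matrix.cons_val_zero, Matrix.cons_val_one] at h0 h1
  exact ⟨h0, h1⟩

/-! ### The local link at one scale -/

/-- **The local link at one scale.**  Fix a scale `0 < δ ≤ η`, a constant `C ≥ 0`, a centre `z` and
two sites `s, s'` with `δ s, δ s' ∈ closedBall z η`.  Suppose that every up-face `upFace k l` of a
row `l ≥ min (s 1) (s' 1)` with `‖δ·(k,l) − z‖ ≤ 19 η` lies in `Λ`, and that on the corresponding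
up-edges, and on the floor edges of the rows `l > min (s 1) (s' 1)`, the observable is bounded by
`C ‖F(b₀)‖`.  Then the increment `H s' − H s` does not depend on the potential `H`, and the
normalised increment satisfies `‖δ (H s' − H s)/F(b₀)‖ ≤ 6 C (‖δ s' − δ s‖ + δ)`. [folklore] -/
theorem core_link {Λ : Finset HexVertex} {a b₀ : Sym2 HexVertex} {s s' : Site 2} {z : ℂ}
    {δ η C : ℝ} (hδ : 0 < δ) (hδη : δ ≤ η) (hC : 0 ≤ C)
    (hs : ‖(δ : ℂ) * triEmbed s - z‖ ≤ η) (hs' : ‖(δ : ℂ) * triEmbed s' - z‖ ≤ η)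
    (hface : ∀ k l : ℤ, min (s 1) (s' 1) ≤ l → ‖(δ : ℂ) * triEmbed ![k, l] - z‖ ≤ 19 * η →
      upFace k l ∈ Λ)
    (hup : ∀ k l : ℤ, min (s 1) (s' 1) ≤ l → ‖(δ : ℂ) * triEmbed ![k, l] - z‖ ≤ 19 * η →
      ‖hexParafermionicObservable Λ a hexCriticalFugacity (5 / 8)
          s(upFace k l, ((![k - 1, l], 1) : HexVertex))‖ ≤
        C * ‖hexParafermionicObservable Λ a hexCriticalFugacity (5 / 8) b₀‖)
    (hfloor : ∀ k l : ℤ, min (s 1) (s' 1) < l → ‖(δ : ℂ) * triEmbed ![k, l] - z‖ ≤ 19 * η →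
      ‖hexParafermionicObservable Λ a hexCriticalFugacity (5 / 8) (floorEdge k l)‖ ≤
        C * ‖hexParafermionicObservable Λ a hexCriticalFugacity (5 / 8) b₀‖) :
    (∀ H H' : Site 2 → ℂ, IsPotential Λ a H → IsPotential Λ a H' → H s' - H s = H' s' - H' s) ∧
    (∀ H : Site 2 → ℂ, IsPotential Λ a H →
      ‖(δ : ℂ) * (H s' - H s) / hexParafermionicObservable Λ a hexCriticalFugacity (5 / 8) b₀‖ ≤
        6 * C * (‖(δ : ℂ) * triEmbed s' - (δ : ℂ) * triEmbed s‖ + δ)) := by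
  set Fb := hexParafermionicObservable Λ a hexCriticalFugacity (5 / 8) b₀ with hFb
  have hsv : s = ![s 0, s 1] := by ext i; fin_cases i <;> simp
  have hsv' : s' = ![s' 0, s' 1] := by ext i; fin_cases i <;> simp
  set i := s 0 with hi
  set j := s 1 with hj
  set i' := s' 0 with hi'
  set j' := s' 1 with hj'
  -- the lattice distance `L / δ` between the two sites
  set L : ℝ := ‖(δ : ℂ) * triEmbed s' - (δ : ℂ) * triEmbed s‖ with hL
  have hδn : ‖(δ : ℂ)‖ = δ := by rw [Complex.norm_real, Real.norm_of_nonneg hδ.le]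
  have hLδ : L = δ * ‖triEmbed ![i', j'] - triEmbed ![i, j]‖ := by
    rw [hL, ← mul_sub, norm_mul, hδn, ← hsv, ← hsv']
  have hL2 : L ≤ 2 * η := by
    calc L = ‖((δ : ℂ) * triEmbed s' - z) - ((δ : ℂ) * triEmbed s - z)‖ := by rw [hL]; ring_nf
      _ ≤ ‖(δ : ℂ) * triEmbed s' - z‖ + ‖(δ : ℂ) * triEmbed s - z‖ := norm_sub_le _ _
      _ ≤ 2 * η := by linarith
  obtain ⟨hai, haj⟩ := abs_sub_le_two_mul_norm i j i' j'
  -- `δ (|Δ₀| + |Δ₁|) ≤ 4 L ≤ 8 η`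
  have hsum : δ * (|((i' - i : ℤ) : ℝ)| + |((j' - j : ℤ) : ℝ)|) ≤ 4 * L := by
    rw [hLδ]; nlinarith [hδ.le, norm_nonneg (triEmbed ![i', j'] - triEmbed ![i, j])]
  -- every site of the box is within `19 η` of `z`
  have hnear : ∀ k l : ℤ, |((k - i : ℤ) : ℝ)| ≤ |((i' - i : ℤ) : ℝ)| →
      |((l - j : ℤ) : ℝ)| ≤ |((j' - j : ℤ) : ℝ)| + 1 → ‖(δ : ℂ) * triEmbed ![k, l] - z‖ ≤ 19 * η := by
    intro k l hk hl
    have h1 : ‖(δ : ℂ) * triEmbed ![k, l] - (δ : ℂ) * triEmbed s‖ ≤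
        δ * (|((i' - i : ℤ) : ℝ)| + |((j' - j : ℤ) : ℝ)| + 1) := by
      rw [← mul_sub, norm_mul, hδn, hsv]
      refine mul_le_mul_of_nonneg_left ?_ hδ.le
      exact (norm_triEmbed_vec2_sub_le k l i j).trans (by linarith)
    calc ‖(δ : ℂ) * triEmbed ![k, l] - z‖
        = ‖((δ : ℂ) * triEmbed ![k, l] - (δ : ℂ) * triEmbed s) + ((δ : ℂ) * triEmbed s - z)‖ := by
          ring_nf
      _ ≤ ‖(δ : ℂ) * triEmbed ![k, l] - (δ : ℂ) * triEmbed s‖ + ‖(δ : ℂ) * triEmbed s - z‖ :=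
          norm_add_le _ _
      _ ≤ δ * (|((i' - i : ℤ) : ℝ)| + |((j' - j : ℤ) : ℝ)| + 1) + η := add_le_add h1 hs
      _ = δ * (|((i' - i : ℤ) : ℝ)| + |((j' - j : ℤ) : ℝ)|) + δ + η := by ring
      _ ≤ 4 * L + η + η := by linarith
      _ ≤ 19 * η := by linarith
  have hB : 0 ≤ C * ‖Fb‖ := mul_nonneg hC (norm_nonneg _)
  -- the box link
  have key := box_link (Λ := Λ) (a := a) i j i' j' hB ?_ ?_
  rotate_left
  · intro k l hk hl1 hl2
    have hk' : |((k - i : ℤ) : ℝ)| ≤ |((i' - i : ℤ) : ℝ)| := by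
      rcases hk with rfl | rfl
      · simp
      · exact le_rfl
    have hl' : |((l - j : ℤ) : ℝ)| ≤ |((j' - j : ℤ) : ℝ)| + 1 := by
      have : |l - j| ≤ |j' - j| := by
        rcases le_total j j' with h | h
        · rw [min_eq_left h] at hl1; rw [max_eq_right h] at hl2
          rw [abs_of_nonneg (show (0 : ℤ) ≤ l - j by omega),
            abs_of_nonneg (show (0 : ℤ) ≤ j' - j by omega)]
          omega
        · rw [min_eq_right h] at hl1; rw [max_eq_left h] at hl2
          rw [abs_of_nonpos (show j' - j ≤ 0 by omega), abs_le]
          constructor <;> omega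
      have h2 : ((|l - j| : ℤ) : ℝ) ≤ ((|j' - j| : ℤ) : ℝ) := by exact_mod_cast this
      push_cast at h2 ⊢
      linarith
    have hmin : min (s 1) (s' 1) ≤ l := hl1
    exact ⟨hface k l hmin (hnear k l hk' hl'), hup k l hmin (hnear k l hk' hl')⟩
  · intro k hk1 hk2
    have hk' : |((k - i : ℤ) : ℝ)| ≤ |((i' - i : ℤ) : ℝ)| := by
      have : |k - i| ≤ |i' - i| := by
        rcases le_total i i' with h | h
        · rw [min_eq_left h] at hk1; rw [max_eq_right h] at hk2
          rw [abs_of_nonneg (by omega), abs_of_nonneg (by omega)]; omega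
        · rw [min_eq_right h] at hk1; rw [max_eq_left h] at hk2
          rw [abs_of_nonpos (show i' - i ≤ 0 by omega)]
          rw [abs_le]; constructor <;> omega
      have h2 : ((|k - i| : ℤ) : ℝ) ≤ ((|i' - i| : ℤ) : ℝ) := by exact_mod_cast this
      push_cast at h2 ⊢
      exact h2
    have hl' : |((max j j' + 1 - j : ℤ) : ℝ)| ≤ |((j' - j : ℤ) : ℝ)| + 1 := by
      have : |max j j' + 1 - j| ≤ |j' - j| + 1 := by
        rcases le_total j j' with h | h
        · rw [max_eq_right h, abs_of_nonneg (show (0 : ℤ) ≤ j' + 1 - j by omega),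
            abs_of_nonneg (show (0 : ℤ) ≤ j' - j by omega)]
          omega
        · rw [max_eq_left h, abs_of_nonneg (show (0 : ℤ) ≤ j + 1 - j by omega)]
          have := abs_nonneg (j' - j); omega
      have h2 : ((|max j j' + 1 - j| : ℤ) : ℝ) ≤ ((|j' - j| + 1 : ℤ) : ℝ) := by exact_mod_cast this
      push_cast at h2 ⊢
      exact h2
    have hmin : min (s 1) (s' 1) < max j j' + 1 := by
      show min j j' < max j j' + 1
      exact lt_of_le_of_lt (min_le_max) (lt_add_one _)
    exact ⟨hface k _ hmin.le (hnear k _ hk' hl'), hfloor k _ hmin (hnear k _ hk' hl')⟩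
  rw [← hsv, ← hsv'] at key
  refine ⟨key.1, fun H hH => ?_⟩
  have hbound := key.2 H hH
  -- `(|Δ₀| + 2|Δ₁| + 2) C ‖Fb‖ ≤ (6 L/δ + 2) C ‖Fb‖`
  by_cases hF0 : Fb = 0
  · rw [hF0, div_zero, norm_zero]
    have : 0 ≤ L := norm_nonneg _
    positivity
  have hFpos : 0 < ‖Fb‖ := norm_pos_iff.2 hF0
  rw [norm_div, norm_mul, hδn, div_le_iff₀ hFpos]
  have h3 : δ * (|((i' - i : ℤ) : ℝ)| + 2 * |((j' - j : ℤ) : ℝ)| + 2) ≤ 6 * L + 2 * δ := by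
    have := abs_nonneg (((i' - i : ℤ) : ℝ))
    nlinarith [hsum, hδ.le, abs_nonneg (((j' - j : ℤ) : ℝ))]
  push_cast at hbound
  calc δ * ‖H s' - H s‖ ≤ δ * ((|(i' : ℝ) - i| + 2 * |(j' : ℝ) - j| + 2) * (C * ‖Fb‖)) :=
        mul_le_mul_of_nonneg_left hbound hδ.le
    _ = δ * (|(i' : ℝ) - i| + 2 * |(j' : ℝ) - j| + 2) * (C * ‖Fb‖) := by ring
    _ ≤ (6 * L + 2 * δ) * (C * ‖Fb‖) := by
        refine mul_le_mul_of_nonneg_right ?_ hB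
        push_cast at h3
        exact h3
    _ ≤ 6 * C * (L + δ) * ‖Fb‖ := by nlinarith [hδ.le, hC, hFpos.le]

/-- **Registered piece `developingMapsCompact_coreLink`** of stub `stub_developingMapsCompact` (crux
stmt-CriticalPhenomena-14004, line `pick-half-plane`): the one-scale local link in registry form (one
`∀`-term; see `core_link`). [folklore] -/
theorem developingMapsCompact_coreLink : ∀ (Λ : Finset HexVertex) (a b₀ : Sym2 HexVertex) (s s' : Site 2) (z : ℂ) (δ η C : ℝ), 0 < δ → δ ≤ η → 0 ≤ C → ‖(δ : ℂ) * triEmbed s - z‖ ≤ η → ‖(δ : ℂ) * triEmbed s' - z‖ ≤ η → (∀ k l : ℤ, min (s 1) (s' 1) ≤ l → ‖(δ : ℂ) * triEmbed ![k, l] - z‖ ≤ 19 * η → upFace k l ∈ Λ) → (∀ k l : ℤ, min (s 1) (s' 1) ≤ l → ‖(δ : ℂ) * triEmbed ![k, l] - z‖ ≤ 19 * η → ‖hexParafermionicObservable Λ a hexCriticalFugacity (5 / 8) s(upFace k l, ((![k - 1, l], 1) : HexVertex))‖ ≤ C * ‖hexParafermionicObservable Λ a hexCriticalFugacity (5 /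 8) b₀‖) → (∀ k l : ℤ, min (s 1) (s' 1) < l → ‖(δ : ℂ) * triEmbed ![k, l] - z‖ ≤ 19 * η → ‖hexParafermionicObservable Λ a hexCriticalFugacity (5 / 8) (floorEdge k l)‖ ≤ C * ‖hexParafermionicObservable Λ a hexCriticalFugacity (5 / 8) b₀‖) → (∀ H H' : Site 2 → ℂ, IsPotential Λ a H → IsPotential Λ a H' → H s' - H s = H' s' - H' s) ∧ (∀ H : Site 2 → ℂ, IsPotential Λ a H → ‖(δ : ℂ) * (H s' - H s) / hexParafermionicObservable Λ a hexCriticalFugacity (5 / 8) b₀‖ ≤ 6 * C * (‖(δ : ℂ) * triEmbed s' - (δ : ℂ) * triEmbed s‖ + δ)) :=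
  fun _ _ _ _ _ _ _ _ _ hδ hδη hC hs hs' hface hup hfloor => core_link hδ hδη hC hs hs' hface hup hfloor

end Summit.CriticalPhenomena.SAWScalingLimit.Theorems.PickHalfPlane.DevelopingMaps

end
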